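import Literature.MathematicalPhysics.QuantumLattice.XYOrderThermalGDProofs
import Literature.MathematicalPhysics.QuantumLattice.XYOrderThermalBoundsProofs
import Literature.Barriers.AtomisticToContinuum.HalfFillingReflectionPositivityProofs
import HarnessLib

/-!
# Kennedy–Lieb–Shastry / Dyson–Lieb–Simon, XY model at positive temperature: the infrared bound for every spin

Trunk T-QLATTICE; sibling proof file of `XYOrder.lean` (item
`provefact-Literature.MathematicalPhysics.QuantumLattice.kennedy_lieb_shastry_xy_thermal`). No
statement and no definition is introduced or changed. For the Gibbs state of the ferromagnetic
quantum XY model `H = xyTorus d L n` of ARBITRARY spin `S = n/2` on the torus `(ℤ/Lℤ)^d` this file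
proves **the infrared bound at positive temperature** ([DLS1978] Thm. 4.1 / eq. (44) with the
transfer Thms. 3.1–3.2; [KLS1988PRL] eq. (4) at `T > 0`; [LSSY2005] (11.8), (11.22)–(11.23) for
spin `½`): for even side `L ≥ 4`, `β > 0` and every momentum `q ≠ 0` of the dual torus,

`0 ≤ ĝ¹_q ≤ 1/(2βE_q) + ½ [Σᵢ (e₁ - e₃ cos qᵢ)/E_q]^{1/2}` (`xy_infraredBound_thermal`),

where `ĝ¹_q = |Λ|⁻¹ Σ_{x,y} cos(q·(x-y)) Re⟨S¹_xS¹_y⟩_β` is the thermal structure factor,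
`E_q = Σᵢ(1 - cos qᵢ)`, and `e_α = (d|Λ|)⁻¹ Σ_x Σᵢ Re⟨S^α_xS^α_{x+eᵢ}⟩_β` are the pair-averaged
nearest-neighbour correlations (all written out explicitly through `Matrix.gibbsState`; no
definition is made). The chain:

* Gaussian domination `Z(H - V_h + ½Q(h)) ≤ Z(H)` (`partitionFn_xyField_le`,
  `XYOrderThermalGDProofs.lean`; [DLS1978] Thm. 4.2) and `Matrix.gaussianDomination_duhamel_le_holds`
  ([DLS1978] (44)) give the Duhamel bound `(V_h, V_h) ≤ Q(h)/β`; for the waves `h = cos(q·)`,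
  `sin(q·)` (`xyGradField_cos/sin`, `xyFieldEnergy_cos_add_sin`) this is
  `(C_q,C_q) + (D_q,D_q) ≤ |Λ|/(2βE_q)`;
* the Falk–Bruch transfer `Matrix.falkBruch_sum_le_of_le` ([DLS1978] Thms. 3.1–3.2 with
  `coth x ≤ 1 + 1/x`) gives `⟨C²⟩ + ⟨D²⟩ ≤ b₀ + ½√(βb₀c)`, `b₀ = |Λ|/(2βE_q)`,
  `c = ⟨[C,[H,C]]⟩ + ⟨[D,[H,D]]⟩`;
* `xy_structureFactorSum_eq_modes` (`|Λ|ĝ¹_q = ⟨C²⟩ + ⟨D²⟩`), the double commutator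
  `re_gibbsState_xy_lie_lie_modes` (`lie_lie_xyTorus`: `c = 2ΣᵢΣ_z(G²(z,z+eᵢ) - cos qᵢ G³(z,z+eᵢ))`),
  (Sᵀ) `G² = G¹` (`gibbsState_xy_corr_one_eq_zero`) and the axis symmetry of the Gibbs state
  (`sum_xy_corr_dir_eq_pairSum_div`: `Σ_z G^α(z,z+eᵢ) = d⁻¹Σ_zΣⱼ G^α(z,z+eⱼ)`) give
  `c = 2|Λ|Σᵢ(e₁ - e₃cos qᵢ)`.

These are the general-spin, zero-field versions of `hc_infraredBound_of_gd` /
`hc_infraredBound_thermal_holds` (`Literature/Barriers/AtomisticToContinuum`, spin `½`) and the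
positive-temperature versions of `xyStructureFactor_eq_modes`, `re_groundStateFunctional_lie_lie_modes`,
`sum_xyGroundCorr_dir_eq` (`XYOrderInfraredProofs.lean`).

## References

* [DLS1978] F. J. Dyson, E. H. Lieb, B. Simon, *Phase transitions in quantum spin systems with
  isotropic and nonisotropic interactions*, J. Stat. Phys. 18 (1978) 335–383, Thms. 3.1–3.2,
  Thm. 4.1, eq. (44), Thm. 4.2 (read in: E. H. Lieb, *Statistical Mechanics (Selecta)*, paper
  IV.3, pp. 160–166).
* [KLS1988PRL] T. Kennedy, E. H. Lieb, B. S. Shastry, Phys. Rev. Lett. 61 (1988) 2582–2584,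
  eq. (4) ("It can be derived as a `T → 0` limit of the bound in DLS").
* [LSSY2005] E. H. Lieb, R. Seiringer, J. P. Solovej, J. Yngvason, *The Mathematics of the Bose
  Gas and its Condensation* (2005), Ch. 11, (11.8), (11.20)–(11.23).
-/

noncomputable section

open Filter Topology Matrix Finset
open Literature.MathematicalPhysics.QuantumLattice Literature.MathematicalPhysics.QuantumLattice.SpinOperators
  Literature.Probability.LatticeModels Literature.Barriers.AtomisticToContinuum.BoseGas
open scoped ComplexOrder

namespace Literature.MathematicalPhysics.QuantumLattice

variable {d : ℕ}

/-! ### The structure factor through the two modes -/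

section Modes

variable (β : ℝ) (L : ℕ) [NeZero L] (n : ℕ)

/-- `⟨A_a A_b⟩_β = Σ_{x,y} a_x b_y ⟨S¹_x S¹_y⟩_β` for real coefficient families (bilinearity of the
Gibbs state). [folklore] -/
theorem gibbsState_xy_wave_mul_wave (a b : TorusSite d L → ℝ) :
    gibbsState β (xyTorus d L n)
        ((∑ x : TorusSite d L, (a x : ℂ) • siteSpin n x 0) *
          ∑ y : TorusSite d L, (b y : ℂ) • siteSpin n y 0) =
      ∑ x : TorusSite d L, ∑ y : TorusSite d L, ((a x * b y : ℝ) : ℂ) *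
        gibbsState β (xyTorus d L n) (siteSpin n x 0 * siteSpin n y 0) := by
  rw [sum_mul_sum, map_sum]
  refine sum_congr rfl fun x _ => ?_
  rw [map_sum]
  refine sum_congr rfl fun y _ => ?_
  rw [smul_mul_assoc, mul_smul_comm, smul_smul, LinearMap.map_smul, smul_eq_mul,
    Complex.ofReal_mul]

/-- **The thermal structure factor through the modes**, for every spin:
`Σ_{x,y} cos(q·(x-y)) Re⟨S¹_xS¹_y⟩_β = Re⟨C_q²⟩_β + Re⟨D_q²⟩_β` with `C_q = Σ_x cos(q·x)S¹_x`,
`D_q = Σ_x sin(q·x)S¹_x` (`cos(q·(x-y)) = cos(q·x)cos(q·y) + sin(q·x)sin(q·y)`).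
[cite: LSSY2005, Ch. 11 (11.22)] [cite: KLS1988PRL, before eq. (2)] -/
theorem xy_structureFactorSum_eq_modes (q : TorusSite d L) :
    ∑ x : TorusSite d L, ∑ y : TorusSite d L, Real.cos (torusPhase L q (x - y)) *
        (gibbsState β (xyTorus d L n) (siteSpin n x 0 * siteSpin n y 0)).re =
      (gibbsState β (xyTorus d L n) (xyCosMode L n q * xyCosMode L n q)).re +
        (gibbsState β (xyTorus d L n) (xySinMode L n q * xySinMode L n q)).re := by
  rw [xyCosMode, xySinMode, gibbsState_xy_wave_mul_wave, gibbsState_xy_wave_mul_wave,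
    Complex.re_sum, Complex.re_sum, ← sum_add_distrib]
  refine sum_congr rfl fun x _ => ?_
  rw [Complex.re_sum, Complex.re_sum, ← sum_add_distrib]
  refine sum_congr rfl fun y _ => ?_
  rw [Complex.re_ofReal_mul, Complex.re_ofReal_mul, cos_torusPhase_sub]
  ring

/-- `Re⟨C²⟩_β ≥ 0` for Hermitian `C` in the Gibbs state of the XY torus (`C² = CᴴC ≥ 0`).
[folklore] -/
theorem re_gibbsState_xy_mul_self_nonneg {C : Op (TorusSite d L) (n + 1)} (hC : C.IsHermitian) :
    0 ≤ (gibbsState β (xyTorus d L n) (C * C)).re := by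
  have hpsd : (C * C).PosSemidef := by
    simpa only [hC.eq] using posSemidef_conjTranspose_mul_self C
  exact (Complex.nonneg_iff.mp
    (gibbsState_nonneg_of_posSemidef β (xyTorus_isHermitian d L n) hpsd)).1

end Modes

/-! ### Gibbs expectations of the double commutators -/

section DoubleCommutators

variable (β : ℝ) (L : ℕ) [NeZero L] (n : ℕ)

/-- The Gibbs expectation of the XY double commutator, edge by edge, for every spin:
`Re⟨[A,[H,A]]⟩_β = Σ_{⟨xy⟩}((a_x² + a_y²) G²(x,y) - 2a_xa_y G³(x,y))` for a real wave `A = Σ a_xS¹_x`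
(`lie_lie_xyTorus`; the bracket is written in product form). [cite: KLS1988PRL, eq. (4)]
[cite: LSSY2005, Ch. 11 (11.20)] -/
theorem re_gibbsState_xy_lie_lie (a : TorusSite d L → ℝ) :
    (gibbsState β (xyTorus d L n)
      ((∑ u : TorusSite d L, (a u : ℂ) • (siteSpin n u 0 : Op (TorusSite d L) (n + 1))) *
          (xyTorus d L n * (∑ u : TorusSite d L, (a u : ℂ) • (siteSpin n u 0 : Op (TorusSite d L) (n + 1))) -
            (∑ u : TorusSite d L, (a u : ℂ) • (siteSpin n u 0 : Op (TorusSite d L) (n + 1))) * xyTorus d L n) -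
        (xyTorus d L n * (∑ u : TorusSite d L, (a u : ℂ) • (siteSpin n u 0 : Op (TorusSite d L) (n + 1))) -
            (∑ u : TorusSite d L, (a u : ℂ) • (siteSpin n u 0 : Op (TorusSite d L) (n + 1))) * xyTorus d L n) *
          (∑ u : TorusSite d L, (a u : ℂ) • (siteSpin n u 0 : Op (TorusSite d L) (n + 1))))).re =
      ∑ e ∈ (torusGraph d L).edgeFinset,
        Sym2.lift ⟨fun x y => (a x ^ 2 + a y ^ 2) *
            (gibbsState β (xyTorus d L n) (siteSpin n x 1 * siteSpin n y 1)).re -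
          2 * a x * a y * (gibbsState β (xyTorus d L n) (siteSpin n x 2 * siteSpin n y 2)).re,
          fun x y => by
            dsimp only
            rw [re_gibbsState_xy_corr_symm β L n 1 x y, re_gibbsState_xy_corr_symm β L n 2 x y]
            ring⟩ e := by
  letI : LieRing (Op (TorusSite d L) (n + 1)) := LieRing.ofAssociativeRing
  show (gibbsState β (xyTorus d L n)
      ⁅(∑ u : TorusSite d L, (a u : ℂ) • (siteSpin n u 0 : Op (TorusSite d L) (n + 1))),
        ⁅xyTorus d L n,
          ∑ u : TorusSite d L, (a u : ℂ) • (siteSpin n u 0 : Op (TorusSite d L) (n + 1))⁆⁆).re = _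
  rw [lie_lie_xyTorus, map_sum, Complex.re_sum]
  refine sum_congr rfl fun e _ => ?_
  refine Sym2.ind (fun x y => ?_) e
  simp only [Sym2.lift_mk, map_sub, LinearMap.map_smul, smul_eq_mul, Complex.sub_re]
  rw [show ((a x : ℂ) ^ 2 + (a y : ℂ) ^ 2) = ((a x ^ 2 + a y ^ 2 : ℝ) : ℂ) by push_cast; ring,
    show (2 * (a x : ℂ) * (a y : ℂ)) = ((2 * a x * a y : ℝ) : ℂ) by push_cast; ring,
    Complex.re_ofReal_mul, Complex.re_ofReal_mul, re_gibbsState_xy_spinBond,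
    re_gibbsState_xy_spinBond]

/-- **The two modes together**, for every spin and side `L ≥ 3`:
`Re⟨[C_q,[H,C_q]]⟩_β + Re⟨[D_q,[H,D_q]]⟩_β = 2ΣᵢΣ_z(G²(z,z+eᵢ) - cos qᵢ G³(z,z+eᵢ))` (in the
product form `A(HA - AH) - (HA - AH)A = [A,[H,A]]` of `DuhamelTwoPoint.lean`).
[cite: LSSY2005, Ch. 11 (11.20)] [cite: KLS1988PRL, eq. (4)] -/
theorem re_gibbsState_xy_lie_lie_modes (hL : 3 ≤ L) (q : TorusSite d L) :
    (gibbsState β (xyTorus d L n) (xyCosMode L n q *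
        (xyTorus d L n * xyCosMode L n q - xyCosMode L n q * xyTorus d L n) -
        (xyTorus d L n * xyCosMode L n q - xyCosMode L n q * xyTorus d L n) * xyCosMode L n q)).re +
      (gibbsState β (xyTorus d L n) (xySinMode L n q *
        (xyTorus d L n * xySinMode L n q - xySinMode L n q * xyTorus d L n) -
        (xyTorus d L n * xySinMode L n q - xySinMode L n q * xyTorus d L n) * xySinMode L n q)).re =
      2 * ∑ i : Fin d, ∑ z : TorusSite d L,
        ((gibbsState β (xyTorus d L n) (siteSpin n z 1 * siteSpin n (z + Pi.single i 1) 1)).re -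
          Real.cos (latticeMomentum L q i) *
            (gibbsState β (xyTorus d L n) (siteSpin n z 2 * siteSpin n (z + Pi.single i 1) 2)).re) := by
  rw [xyCosMode, xySinMode, re_gibbsState_xy_lie_lie, re_gibbsState_xy_lie_lie, ← sum_add_distrib]
  have hcomb : ∀ e ∈ (torusGraph d L).edgeFinset,
      Sym2.lift ⟨fun x y => (Real.cos (torusPhase L q x) ^ 2 + Real.cos (torusPhase L q y) ^ 2) *
          (gibbsState β (xyTorus d L n) (siteSpin n x 1 * siteSpin n y 1)).re -
          2 * Real.cos (torusPhase L q x) * Real.cos (torusPhase L q y) *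
          (gibbsState β (xyTorus d L n) (siteSpin n x 2 * siteSpin n y 2)).re, fun x y => by
            dsimp only
            rw [re_gibbsState_xy_corr_symm β L n 1 x y, re_gibbsState_xy_corr_symm β L n 2 x y]
            ring⟩ e +
        Sym2.lift ⟨fun x y => (Real.sin (torusPhase L q x) ^ 2 + Real.sin (torusPhase L q y) ^ 2) *
          (gibbsState β (xyTorus d L n) (siteSpin n x 1 * siteSpin n y 1)).re -
          2 * Real.sin (torusPhase L q x) * Real.sin (torusPhase L q y) *
          (gibbsState β (xyTorus d L n) (siteSpin n x 2 * siteSpin n y 2)).re, fun x y => by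
            dsimp only
            rw [re_gibbsState_xy_corr_symm β L n 1 x y, re_gibbsState_xy_corr_symm β L n 2 x y]
            ring⟩ e =
      2 * Sym2.lift ⟨fun x y => (gibbsState β (xyTorus d L n) (siteSpin n x 1 * siteSpin n y 1)).re -
          Real.cos (torusPhase L q (x - y)) *
            (gibbsState β (xyTorus d L n) (siteSpin n x 2 * siteSpin n y 2)).re, fun x y => by
            dsimp only
            rw [re_gibbsState_xy_corr_symm β L n 1 x y, re_gibbsState_xy_corr_symm β L n 2 x y,
              cos_torusPhase_sub, cos_torusPhase_sub]
            ring⟩ e := by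
    intro e _
    refine Sym2.ind (fun x y => ?_) e
    simp only [Sym2.lift_mk]
    rw [cos_torusPhase_sub]
    linear_combination ((gibbsState β (xyTorus d L n) (siteSpin n x 1 * siteSpin n y 1)).re) *
      Real.cos_sq_add_sin_sq (torusPhase L q x) +
      ((gibbsState β (xyTorus d L n) (siteSpin n x 1 * siteSpin n y 1)).re) *
      Real.cos_sq_add_sin_sq (torusPhase L q y)
  rw [sum_congr rfl hcomb, ← mul_sum]
  congr 1
  have hpairs := sum_pairs_eq_sum_edgeFinset (d := d) L (by omega)
    (Sym2.lift ⟨fun x y => (gibbsState β (xyTorus d L n) (siteSpin n x 1 * siteSpin n y 1)).re -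
      Real.cos (torusPhase L q (x - y)) *
        (gibbsState β (xyTorus d L n) (siteSpin n x 2 * siteSpin n y 2)).re, fun x y => by
        dsimp only
        rw [re_gibbsState_xy_corr_symm β L n 1 x y, re_gibbsState_xy_corr_symm β L n 2 x y,
          cos_torusPhase_sub, cos_torusPhase_sub]
        ring⟩)
  rw [if_neg (by omega), one_mul] at hpairs
  rw [← hpairs, sum_comm]
  refine sum_congr rfl fun i _ => sum_congr rfl fun z _ => ?_
  simp only [Sym2.lift_mk]
  rw [sub_add_cancel_left, cos_torusPhase_neg_single]

end DoubleCommutators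

/-! ### Axis permutations are symmetries of the Gibbs state -/

section Symmetry

variable (β : ℝ) (L : ℕ) [NeZero L] (n : ℕ)

/-- The thermal two-point function of the XY torus is invariant under permutations of the
coordinate axes: `G^α(x ∘ s, y ∘ s) = G^α(x, y)` (`xyTorus_submatrix_comp_perm` and the invariance
of Gibbs states under site relabellings fixing `H`). [folklore] -/
theorem gibbsState_xy_corr_comp_perm (s : Equiv.Perm (Fin d)) (α : Fin 3) (x y : TorusSite d L) :
    gibbsState β (xyTorus d L n) (siteSpin n (x ∘ s) α * siteSpin n (y ∘ s) α) =
      gibbsState β (xyTorus d L n) (siteSpin n x α * siteSpin n y α) := by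
  rw [← arrowCongr_symm_apply L s x, ← arrowCongr_symm_apply L s y,
    ← siteSpin_submatrix_comp n _ x α, ← siteSpin_submatrix_comp n _ y α,
    ← Matrix.submatrix_mul _ _ _ _ _ (bijective_comp_equiv (q := n + 1) _),
    gibbsState_submatrix_comp _ (xyTorus_submatrix_comp_perm L n s) β]

/-- **Direction independence of the thermal nearest-neighbour correlations**:
`Σ_z G^α(z, z + eᵢ) = Σ_z G^α(z, z + eⱼ)` (the transposition of the axes `i`, `j`).
[cite: KLS1988PRL, eq. (3)] -/
theorem sum_xy_corr_dir_eq (α : Fin 3) (i j : Fin d) :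
    ∑ z : TorusSite d L, (gibbsState β (xyTorus d L n)
        (siteSpin n z α * siteSpin n (z + Pi.single i 1) α)).re =
      ∑ z : TorusSite d L, (gibbsState β (xyTorus d L n)
        (siteSpin n z α * siteSpin n (z + Pi.single j 1) α)).re := by
  have hsi : (Equiv.swap i j).symm i = j := by rw [Equiv.symm_swap, Equiv.swap_apply_left]
  calc ∑ z : TorusSite d L, (gibbsState β (xyTorus d L n)
        (siteSpin n z α * siteSpin n (z + Pi.single i 1) α)).re
      = ∑ z : TorusSite d L, (gibbsState β (xyTorus d L n)
          (siteSpin n (z ∘ Equiv.swap i j) α *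
            siteSpin n ((z ∘ Equiv.swap i j : TorusSite d L) + Pi.single j 1) α)).re :=
        sum_congr rfl fun z _ => by
          rw [← gibbsState_xy_corr_comp_perm β L n (Equiv.swap i j) α z, add_single_comp_perm, hsi]
    _ = ∑ z : TorusSite d L, (gibbsState β (xyTorus d L n)
          (siteSpin n z α * siteSpin n (z + Pi.single j 1) α)).re :=
        (Equiv.arrowCongr (Equiv.swap i j).symm (Equiv.refl (ZMod L))).sum_comp
          (fun z => (gibbsState β (xyTorus d L n)
            (siteSpin n z α * siteSpin n (z + Pi.single j 1) α)).re)

/-- (SYM) for the pair sums: `Σ_z G^α(z, z+eᵢ) = d⁻¹ Σ_z Σⱼ G^α(z, z+eⱼ)` for every direction `i`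
(`d ≥ 1`). [cite: KLS1988PRL, eq. (3)] -/
theorem sum_xy_corr_dir_eq_pairSum_div (hd : 0 < d) (α : Fin 3) (i : Fin d) :
    ∑ z : TorusSite d L, (gibbsState β (xyTorus d L n)
        (siteSpin n z α * siteSpin n (z + Pi.single i 1) α)).re =
      (∑ z : TorusSite d L, ∑ j : Fin d, (gibbsState β (xyTorus d L n)
        (siteSpin n z α * siteSpin n (z + Pi.single j 1) α)).re) / d := by
  have hd' : (0 : ℝ) < d := by exact_mod_cast hd
  rw [eq_div_iff hd'.ne', sum_comm, sum_congr rfl fun j _ => sum_xy_corr_dir_eq β L n α j i,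
    sum_const, card_univ, Fintype.card_fin, nsmul_eq_mul, mul_comm]

end Symmetry

/-! ### (GD) ⇒ (Aᵀ) in finite volume, for every spin -/

section Infrared

/-- **Thermal Gaussian domination ⇒ the infrared bound, in finite volume, for every spin.** For
`d ≥ 1`, side `L ≥ 3`, `β > 0` and a momentum `q ≠ 0` of the dual torus: if
`Z_β(H - V_h + ½Q(h)) ≤ Z_β(H)` for every real field `h` (`H = xyTorus d L n`), then
`0 ≤ ĝ¹_q ≤ 1/(2βE_q) + ½[Σᵢ(e₁ - e₃ cos qᵢ)/E_q]^{1/2}` for the thermal structure factor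
`ĝ¹_q = L^{-d}Σ_{x,y}cos(q·(x-y))Re⟨S¹_xS¹_y⟩_β` and the pair averages
`e_α = (dL^d)⁻¹Σ_xΣᵢ Re⟨S^α_xS^α_{x+eᵢ}⟩_β`.
[cite: DysonLiebSimon1978, Thms. 3.1–3.2, Thm. 4.1, eq. (44)]
[cite: LSSY2005, Ch. 11 (11.8), (11.20)–(11.23)] [cite: KLS1988PRL, eq. (4)] -/
theorem xy_infraredBound_thermal_of_gd (L : ℕ) [NeZero L] (hL : 3 ≤ L) (hd : 0 < d) (n : ℕ)
    {β : ℝ} (hβ : 0 < β)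
    (hGD : ∀ h : TorusSite d L → ℝ,
      (partitionFn β (xyTorus d L n - xyGradField L n h +
        ((xyFieldEnergy L h / 2 : ℝ) : ℂ) • (1 : Op (TorusSite d L) (n + 1)))).re ≤
        (partitionFn β (xyTorus d L n)).re)
    (q : TorusSite d L) (hq : q ≠ 0) :
    0 ≤ (∑ x : TorusSite d L, ∑ y : TorusSite d L, Real.cos (torusPhase L q (x - y)) *
          (gibbsState β (xyTorus d L n) (siteSpin n x 0 * siteSpin n y 0)).re) / (L : ℝ) ^ d ∧
      (∑ x : TorusSite d L, ∑ y : TorusSite d L, Real.cos (torusPhase L q (x - y)) *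
          (gibbsState β (xyTorus d L n) (siteSpin n x 0 * siteSpin n y 0)).re) / (L : ℝ) ^ d ≤
        1 / (2 * β * dispersion (latticeMomentum L q)) +
          1 / 2 * Real.sqrt ((∑ i : Fin d,
            ((∑ x : TorusSite d L, ∑ j : Fin d, (gibbsState β (xyTorus d L n)
                (siteSpin n x 0 * siteSpin n (x + Pi.single j 1) 0)).re) / ((d : ℝ) * (L : ℝ) ^ d) -
              (∑ x : TorusSite d L, ∑ j : Fin d, (gibbsState β (xyTorus d L n)
                (siteSpin n x 2 * siteSpin n (x + Pi.single j 1) 2)).re) / ((d : ℝ) * (L : ℝ) ^ d) *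
                Real.cos (latticeMomentum L q i))) / dispersion (latticeMomentum L q)) := by
  -- notation
  have hH : (xyTorus d L n).IsHermitian := xyTorus_isHermitian d L n
  set E : ℝ := dispersion (latticeMomentum L q) with hE_def
  have hE : 0 < E := dispersion_latticeMomentum_pos hq
  set C : Op (TorusSite d L) (n + 1) := xyCosMode L n q with hC_def
  set D : Op (TorusSite d L) (n + 1) := xySinMode L n q with hD_def
  have hC : C.IsHermitian := xyCosMode_isHermitian L n q
  have hD : D.IsHermitian := xySinMode_isHermitian L n q
  have hLd : 0 < (L : ℝ) ^ d := by
    have : (0 : ℝ) < L := by exact_mod_cast Nat.pos_of_ne_zero (NeZero.ne L)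
    positivity
  have hd' : (0 : ℝ) < d := by exact_mod_cast hd
  haveI : Nonempty (TensorIndex (TorusSite d L) (n + 1)) := ⟨fun _ => 0⟩
  set P0 : ℝ := ∑ x : TorusSite d L, ∑ j : Fin d, (gibbsState β (xyTorus d L n)
    (siteSpin n x 0 * siteSpin n (x + Pi.single j 1) 0)).re with hP0_def
  set P2 : ℝ := ∑ x : TorusSite d L, ∑ j : Fin d, (gibbsState β (xyTorus d L n)
    (siteSpin n x 2 * siteSpin n (x + Pi.single j 1) 2)).re with hP2_def
  set Sg : ℝ := ∑ i : Fin d, (P0 / ((d : ℝ) * (L : ℝ) ^ d) -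
    P2 / ((d : ℝ) * (L : ℝ) ^ d) * Real.cos (latticeMomentum L q i)) with hSg_def
  -- (1) the Duhamel infrared bound `(V_h, V_h) ≤ Q(h)/β` from Gaussian domination
  have hDuh : ∀ h : TorusSite d L → ℝ,
      (duhamel β (xyTorus d L n) (xyGradField L n h) (xyGradField L n h)).re ≤ xyFieldEnergy L h / β := by
    intro h
    refine gaussianDomination_duhamel_le_holds _ β hβ (xyTorus d L n) (xyGradField L n h) hH
      (xyGradField_isHermitian L n h) (xyFieldEnergy L h) (fun t => ?_)
    have := hGD (t • h)
    rwa [xyGradField_smul, xyFieldEnergy_smul] at this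
  -- (2) the two modes: `(C,C) + (D,D) ≤ |Λ|/(2βE)`
  set b₀ : ℝ := (L : ℝ) ^ d / (2 * β * E) with hb₀_def
  have hb₀ : 0 ≤ b₀ := by positivity
  have hmode : ∀ {W : Op (TorusSite d L) (n + 1)} {h : TorusSite d L → ℝ},
      xyGradField L n h = ((2 * E : ℝ) : ℂ) • W →
        (2 * E) ^ 2 * (duhamel β (xyTorus d L n) W W).re ≤ xyFieldEnergy L h / β := by
    intro W h hVh
    have h1 := hDuh h
    rw [hVh, duhamel_smul_smul, show ((2 * E : ℝ) : ℂ) * ((2 * E : ℝ) : ℂ) = (((2 * E) ^ 2 : ℝ) : ℂ) by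
      push_cast; ring, Complex.re_ofReal_mul] at h1
    exact h1
  have hb : (duhamel β (xyTorus d L n) C C).re + (duhamel β (xyTorus d L n) D D).re ≤ b₀ := by
    have h1 := hmode (xyGradField_cos L n q)
    have h2 := hmode (xyGradField_sin L n q)
    have hQ := xyFieldEnergy_cos_add_sin L q
    rw [← hE_def] at hQ
    have h4E : (0 : ℝ) < (2 * E) ^ 2 := by positivity
    have hsum : (2 * E) ^ 2 * ((duhamel β (xyTorus d L n) C C).re + (duhamel β (xyTorus d L n) D D).re) ≤
        2 * E * (L : ℝ) ^ d / β := by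
      rw [mul_add, ← hQ, add_div]
      exact add_le_add h1 h2
    rw [hb₀_def, le_div_iff₀ (by positivity)]
    rw [le_div_iff₀ hβ] at hsum
    nlinarith [hsum, hE]
  -- (3) Falk–Bruch for the pair `(C, D)`
  have hA : ∀ k : Fin 2, ((![C, D] : Fin 2 → Op (TorusSite d L) (n + 1)) k).IsHermitian := by
    intro k
    fin_cases k
    · exact hC
    · exact hD
  have hFB := falkBruch_sum_le_of_le hH hβ.le hA (b₀ := b₀)
    (by simpa only [Fin.sum_univ_two, Matrix.cons_val_zero, Matrix.cons_val_one] using hb)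
  simp only [Fin.sum_univ_two, Matrix.cons_val_zero, Matrix.cons_val_one] at hFB
  -- (4) the two sides: `|Λ| ĝ` and the double commutator
  have hlhs : ∑ x : TorusSite d L, ∑ y : TorusSite d L, Real.cos (torusPhase L q (x - y)) *
      (gibbsState β (xyTorus d L n) (siteSpin n x 0 * siteSpin n y 0)).re =
      (gibbsState β (xyTorus d L n) (C * C)).re + (gibbsState β (xyTorus d L n) (D * D)).re :=
    xy_structureFactorSum_eq_modes β L n q
  set c : ℝ := (gibbsState β (xyTorus d L n) (C * ((xyTorus d L n) * C - C * (xyTorus d L n)) - ((xyTorus d L n) * C - C * (xyTorus d L n)) * C)).re +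
    (gibbsState β (xyTorus d L n) (D * ((xyTorus d L n) * D - D * (xyTorus d L n)) - ((xyTorus d L n) * D - D * (xyTorus d L n)) * D)).re with hc_def
  have hc0 : 0 ≤ c := add_nonneg (hH.re_gibbsState_doubleComm_nonneg hC hβ.le)
    (hH.re_gibbsState_doubleComm_nonneg hD hβ.le)
  have hcle : c ≤ (L : ℝ) ^ d * (2 * Sg) := by
    have h1 := re_gibbsState_xy_lie_lie_modes β L n hL q
    have hS : ∀ z w : TorusSite d L, (gibbsState β (xyTorus d L n) (siteSpin n z 1 * siteSpin n w 1)).re =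
        (gibbsState β (xyTorus d L n) (siteSpin n z 0 * siteSpin n w 0)).re :=
      fun z w => by rw [gibbsState_xy_corr_one_eq_zero]
    have hdir : 2 * ∑ i : Fin d, ∑ z : TorusSite d L,
        ((gibbsState β (xyTorus d L n) (siteSpin n z 1 * siteSpin n (z + Pi.single i 1) 1)).re -
          Real.cos (latticeMomentum L q i) *
            (gibbsState β (xyTorus d L n) (siteSpin n z 2 * siteSpin n (z + Pi.single i 1) 2)).re) =
        (L : ℝ) ^ d * (2 * Sg) := by
      rw [hSg_def, hP0_def, hP2_def, mul_sum, mul_sum, mul_sum]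
      refine sum_congr rfl fun i _ => ?_
      simp only [hS]
      rw [sum_sub_distrib, ← mul_sum, sum_xy_corr_dir_eq_pairSum_div β L n hd 0 i,
        sum_xy_corr_dir_eq_pairSum_div β L n hd 2 i]
      field_simp
    rw [hdir] at h1
    exact h1.le
  -- (5) positivity of `ĝ`
  have haC : 0 ≤ (gibbsState β (xyTorus d L n) (C * C)).re := re_gibbsState_xy_mul_self_nonneg β L n hC
  have haD : 0 ≤ (gibbsState β (xyTorus d L n) (D * D)).re := re_gibbsState_xy_mul_self_nonneg β L n hD
  have hg0 : 0 ≤ (∑ x : TorusSite d L, ∑ y : TorusSite d L, Real.cos (torusPhase L q (x - y)) *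
      (gibbsState β (xyTorus d L n) (siteSpin n x 0 * siteSpin n y 0)).re) / (L : ℝ) ^ d := by
    rw [hlhs]
    exact div_nonneg (add_nonneg haC haD) hLd.le
  refine ⟨hg0, ?_⟩
  -- (6) assemble: `|Λ|ĝ ≤ b₀ + ½√(βb₀c) ≤ b₀ + ½ |Λ| √(Sg/E)`
  have hsqrt : Real.sqrt (β * b₀ * c) ≤ (L : ℝ) ^ d * Real.sqrt (Sg / E) := by
    have h1 : β * b₀ * c ≤ ((L : ℝ) ^ d) ^ 2 * (Sg / E) := by
      calc β * b₀ * c ≤ β * b₀ * ((L : ℝ) ^ d * (2 * Sg)) :=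
            mul_le_mul_of_nonneg_left hcle (by positivity)
        _ = ((L : ℝ) ^ d) ^ 2 * (Sg / E) := by
            rw [hb₀_def]
            field_simp
    calc Real.sqrt (β * b₀ * c) ≤ Real.sqrt (((L : ℝ) ^ d) ^ 2 * (Sg / E)) := Real.sqrt_le_sqrt h1
      _ = (L : ℝ) ^ d * Real.sqrt (Sg / E) := by
          rw [Real.sqrt_mul (sq_nonneg _), Real.sqrt_sq hLd.le]
  have hmain : ∑ x : TorusSite d L, ∑ y : TorusSite d L, Real.cos (torusPhase L q (x - y)) *
      (gibbsState β (xyTorus d L n) (siteSpin n x 0 * siteSpin n y 0)).re ≤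
      b₀ + 1 / 2 * ((L : ℝ) ^ d * Real.sqrt (Sg / E)) := by
    rw [hlhs]
    calc (gibbsState β (xyTorus d L n) (C * C)).re + (gibbsState β (xyTorus d L n) (D * D)).re
        ≤ b₀ + 1 / 2 * Real.sqrt (β * b₀ * c) := hFB
      _ ≤ b₀ + 1 / 2 * ((L : ℝ) ^ d * Real.sqrt (Sg / E)) := by gcongr
  have hb₀' : b₀ = (L : ℝ) ^ d * (1 / (2 * β * E)) := by rw [hb₀_def]; ring
  rw [hb₀'] at hmain
  rw [div_le_iff₀ hLd]
  calc ∑ x : TorusSite d L, ∑ y : TorusSite d L, Real.cos (torusPhase L q (x - y)) *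
        (gibbsState β (xyTorus d L n) (siteSpin n x 0 * siteSpin n y 0)).re
      ≤ (L : ℝ) ^ d * (1 / (2 * β * E)) + 1 / 2 * ((L : ℝ) ^ d * Real.sqrt (Sg / E)) := hmain
    _ = (1 / (2 * β * E) + 1 / 2 * Real.sqrt (Sg / E)) * (L : ℝ) ^ d := by ring

/-- **The infrared bound at positive temperature for the quantum XY model of arbitrary spin**
([DLS1978] Thm. 4.1/(44) with Thms. 3.1–3.2, from Gaussian domination Thm. 4.2; [KLS1988PRL]
eq. (4) at `T > 0`): on the even torus `(ℤ/Lℤ)^d` of side `L ≥ 4`, `d ≥ 1`, for every spin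
`n/2`, `β > 0` and momentum `q ≠ 0`,
`0 ≤ ĝ¹_q ≤ 1/(2βE_q) + ½[Σᵢ(e₁ - e₃cos qᵢ)/E_q]^{1/2}` (thermal structure factor and pair-averaged
nearest-neighbour correlations of the Gibbs state of `xyTorus d L n`, written out through
`Matrix.gibbsState`). Unconditional: Gaussian domination is `partitionFn_xyField_le`.
[cite: DysonLiebSimon1978, Thms. 3.1–3.2, 4.1, 4.2, eq. (44)] [cite: KLS1988PRL, eq. (4)] -/
theorem xy_infraredBound_thermal (L : ℕ) [NeZero L] (hLe : Even L) (hL4 : 4 ≤ L) (hd : 0 < d)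
    (n : ℕ) {β : ℝ} (hβ : 0 < β) (q : TorusSite d L) (hq : q ≠ 0) :
    0 ≤ (∑ x : TorusSite d L, ∑ y : TorusSite d L, Real.cos (torusPhase L q (x - y)) *
          (gibbsState β (xyTorus d L n) (siteSpin n x 0 * siteSpin n y 0)).re) / (L : ℝ) ^ d ∧
      (∑ x : TorusSite d L, ∑ y : TorusSite d L, Real.cos (torusPhase L q (x - y)) *
          (gibbsState β (xyTorus d L n) (siteSpin n x 0 * siteSpin n y 0)).re) / (L : ℝ) ^ d ≤
        1 / (2 * β * dispersion (latticeMomentum L q)) +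
          1 / 2 * Real.sqrt ((∑ i : Fin d,
            ((∑ x : TorusSite d L, ∑ j : Fin d, (gibbsState β (xyTorus d L n)
                (siteSpin n x 0 * siteSpin n (x + Pi.single j 1) 0)).re) / ((d : ℝ) * (L : ℝ) ^ d) -
              (∑ x : TorusSite d L, ∑ j : Fin d, (gibbsState β (xyTorus d L n)
                (siteSpin n x 2 * siteSpin n (x + Pi.single j 1) 2)).re) / ((d : ℝ) * (L : ℝ) ^ d) *
                Real.cos (latticeMomentum L q i))) / dispersion (latticeMomentum L q)) :=
  xy_infraredBound_thermal_of_gd L (by omega) hd n hβ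
    (fun h => partitionFn_xyField_le L hLe hL4 n hβ h) q hq

end Infrared

end Literature.MathematicalPhysics.QuantumLattice
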